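import Summits.NavierStokesRegularity.FluidComputer.AbcCrayaAssembly
import Summits.NavierStokesRegularity.FluidComputer.AbcLatticePairingDomain

/-!
# The (A4) pairing bound on the GRAPH DOMAIN in Craya coordinates
(instab3 g5 — implementation 1 of the skew-cut X0 certifier, cell `ns-blowup`, 2026-08-26)

HONEST FRAMING (human ruling D-0035): nothing here is a claim about Navier–Stokes blow-up.
WHAT THIS IS NOT: not NS evidence; MODEL lane (linearisation about `Torus.abcFlow 1 1 1`); no
certificate is used or moved. Sequel of `AbcCrayaAssembly` §8 (the pairing on finite SECTIONS):
here the pairing `i ↦ conj(u_i) (A u)_i` of the certifier's matrix `A = abcCrayaMatrix 1 1 1` is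
controlled on the whole graph domain, which is how hypothesis `hpair` of
`SkewCutGalerkinTailForm.not_eigenvalue_of_structure` is consumed (all of the head's orthogonal
complement, `u = d·w` an `H²` family — not only Galerkin sections):

* `summable_sum_crayaNbr` — band sums of a summable weighted family are summable (twelve shifted
  slices); `summable_norm_conj_mul_abcCrayaMatrix` — for `∑_i (1+|k_i|²)|u_i|² < ∞` the pairing family
  is ABSOLUTELY summable (`‖A_ij‖ ≤ 9S⟨k_j⟩`, `2ab ≤ a² + b²`, band cardinality `≤ 12`);
* `tsum_crayaIdx_eq_tsum_freq` — tail sums over the Craya index set are frequency sums of fibre sums;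
* **`abs_re_tsum_conj_mul_abcCrayaMatrix_le`** — `|Re ∑'_i conj(u_i)(A u)_i| ≤ √2 ∑'_i |u_i|²` for every
  `u` with `∑_i (1+|k_i|²)|u_i|² < ∞`: implementation 2's Cartesian graph-domain bound
  `AbcLatticePairingDomain.abs_re_tsum_inner_crossForm_le` (instab4 g5) transported through
  `crayaSynth` by the per-frequency identity `∑_a conj(u(k,a))(Au)_{(k,a)} = ⟪c(k), X c(k)⟫`;
* **`re_inner_apply_diagonal_le`** — the hypothesis `hpair` ITSELF for the Craya instantiation: for
  any Hilbert basis `b` on `CrayaIdx`, the standard symbol `d_i = (x₀ + ν|k_i|²)⁻¹` and any bounded `T`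
  with coordinates `⟪b i, T x⟫ = ∑'_j (A_ij d_j)⟪b j, x⟫`: `Re ⟪T w, S₀ w⟫ ≤ √2 ‖S₀ w‖²` for EVERY `w`
  (`S₀ = b.diagonalCLM d`; Parseval `hasSum_norm_sq_inner`).

Mathlib + tree files only; no definitions.
-/

noncomputable section

open scoped BigOperators InnerProductSpace ComplexConjugate Matrix
open Finset Matrix Filter Topology

namespace Summit.NavierStokesRegularity.FluidComputer.AbcCrayaPairingDomain

open Literature.Analysis.FluidPDE Literature.Analysis.FluidPDE.SteadyLattice
open Literature.Analysis.FunctionSpaces Literature.Analysis.FunctionSpaces.Torus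
open Summit.NavierStokesRegularity.FluidComputer.CrayaFrames
open Summit.NavierStokesRegularity.FluidComputer.AbcCrayaMatrix

/-! ### §10 The pairing on the GRAPH DOMAIN in Craya coordinates (`hpair` beyond sections) -/

/-- Per-frequency identity: the fibre sum of `conj(u_i) (A u)_i` over the two frame labels at a
non-zero frequency `k` is the Cartesian pairing `⟪c(k), X c(k)⟫`, `c = crayaSynth u`. -/
theorem sum_fibre_conj_mul_eq_inner (A B C : ℝ) (u : CrayaIdx → ℂ) (k' : {k : Fin 3 → ℤ // k ≠ 0}) :
    ∑ a : Fin 2, conj (u (k', a)) * ∑ j ∈ crayaNbr (k', a), abcCrayaMatrix A B C (k', a) j * u j =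
      ⟪crayaSynth u k'.1, ∑ y : Fin 3 × Bool,
        WithLp.toLp 2 (WithLp.ofLp (Torus.abcCoeff A B C (Torus.abcDir y)) ⨯₃
          (Complex.I • ((fun m : Fin 3 => (((k'.1 - Torus.abcDir y) m : ℤ) : ℂ)) ⨯₃
            WithLp.ofLp (crayaSynth u (k'.1 - Torus.abcDir y))) -
            WithLp.ofLp (crayaSynth u (k'.1 - Torus.abcDir y))))⟫_ℂ := by
  rw [AbcCrayaAssembly.inner_crayaSynth_left u k'.2]
  refine Finset.sum_congr rfl fun a _ => ?_
  rw [sum_abcCrayaMatrix_mul_eq_inner]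

/-- A weight on `ℤ³` summed over the band: `i ↦ ∑_{j ∈ band(i)} W(k_j) |u_j|²` is summable whenever
`i ↦ W(k_i)|u_i|²` is (each of the twelve shifted slices is a shifted copy of a summable family). -/
theorem summable_sum_crayaNbr (u : CrayaIdx → ℂ) {W : (Fin 3 → ℤ) → ℝ} (hW : ∀ k, 0 ≤ W k)
    (hu : Summable fun i : CrayaIdx => W i.1.1 * ‖u i‖ ^ 2) :
    Summable fun i : CrayaIdx => ∑ j ∈ crayaNbr i, W j.1.1 * ‖u j‖ ^ 2 := by
  classical
  -- the zero extension of the weighted family to all of `ℤ³ × Fin 2`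
  set E : (Fin 3 → ℤ) → Fin 2 → ℝ := fun k b =>
    if h : k = 0 then 0 else W k * ‖u (⟨k, h⟩, b)‖ ^ 2 with hE
  have hE0 : ∀ k b, 0 ≤ E k b := fun k b => by
    rw [hE]; dsimp only; split_ifs
    · exact le_rfl
    · exact mul_nonneg (hW k) (sq_nonneg _)
  -- each slice `k ↦ E k b` is summable over `ℤ³`
  have hEs : ∀ b, Summable fun k : Fin 3 → ℤ => E k b := by
    intro b
    apply summable_of_summable_ne_zero
    have h := summable_weight_norm_sq_slice u (w := W) hu b
    refine h.congr fun k' => ?_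
    rw [hE]; dsimp only; rw [dif_neg k'.2]
  -- hence each shifted slice is summable over the Craya index set
  have hshift : ∀ (y : Fin 3 × Bool) (b : Fin 2),
      Summable fun i : CrayaIdx => E (i.1.1 - Torus.abcDir y) b := by
    intro y b
    have h1 : Summable fun k : Fin 3 → ℤ => E (k - Torus.abcDir y) b := by
      have h := (Equiv.summable_iff (Equiv.subRight (Torus.abcDir y)) (f := fun k => E k b)).mpr (hEs b)
      exact h.congr fun k => rfl
    have h2 : Summable fun k' : {k : Fin 3 → ℤ // k ≠ 0} => E (k'.1 - Torus.abcDir y) b :=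
      h1.comp_injective Subtype.val_injective
    -- a function of the frequency only, on `{k ≠ 0} × Fin 2`
    have h3 : Summable fun p : {k : Fin 3 → ℤ // k ≠ 0} × Fin 2 => E (p.1.1 - Torus.abcDir y) b := by
      refine (summable_prod_of_nonneg fun p => hE0 _ _).mpr ⟨fun k' => ?_, ?_⟩
      · exact (hasSum_fintype _).summable
      · simp only [tsum_fintype, Finset.sum_const, Finset.card_univ, Fintype.card_fin, nsmul_eq_mul,
          Nat.cast_ofNat]
        exact h2.mul_left 2
    exact h3
  -- the band sum is the finite sum of the shifted slices
  have hsum := summable_sum (s := (Finset.univ : Finset (Fin 3 × Bool))) fun y _ =>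
    summable_sum (s := (Finset.univ : Finset (Fin 2))) fun b _ => hshift y b
  refine hsum.congr fun i => ?_
  rw [sum_crayaNbr_eq]

/-- **Absolute summability of the pairing family on the graph domain.** If
`∑_i (1 + |k_i|²)|u_i|² < ∞` then `i ↦ conj(u_i) (A u)_i` (`A = abcCrayaMatrix A B C`) is absolutely
summable: `|conj(u_i)(Au)_i| ≤ |u_i| ∑_{j ∈ band} 9S⟨k_j⟩|u_j| ≤ (9S/2) ∑_{j ∈ band} (|u_i|² + ⟨k_j⟩²|u_j|²)`. -/
theorem summable_norm_conj_mul_abcCrayaMatrix (A B C : ℝ) (u : CrayaIdx → ℂ)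
    (hu : Summable fun i : CrayaIdx => (1 + freqNormSq i.1.1) * ‖u i‖ ^ 2) :
    Summable fun i : CrayaIdx => ‖conj (u i) * ∑ j ∈ crayaNbr i, abcCrayaMatrix A B C i j * u j‖ := by
  set S : ℝ := |A| + |B| + |C| with hS
  have hS0 : 0 ≤ S := by rw [hS]; positivity
  have hu0 : Summable fun i : CrayaIdx => ‖u i‖ ^ 2 := by
    refine Summable.of_nonneg_of_le (fun i => sq_nonneg _) (fun i => ?_) hu
    have := freqNormSq_nonneg i.1.1
    nlinarith [sq_nonneg ‖u i‖]
  have hband := summable_sum_crayaNbr u (W := fun k => 1 + freqNormSq k)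
    (fun k => by linarith [freqNormSq_nonneg k]) hu
  -- majorant
  have hmaj := (hu0.mul_left (9 * S / 2 * 12)).add (hband.mul_left (9 * S / 2))
  refine Summable.of_nonneg_of_le (fun i => norm_nonneg _) (fun i => ?_) hmaj
  rw [norm_mul, RCLike.norm_conj]
  have hrow : ‖∑ j ∈ crayaNbr i, abcCrayaMatrix A B C i j * u j‖ ≤
      ∑ j ∈ crayaNbr i, 9 * S * sobolevWeight 1 j.1.1 * ‖u j‖ := by
    refine (norm_sum_le _ _).trans (Finset.sum_le_sum fun j _ => ?_)
    rw [norm_mul]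
    exact mul_le_mul_of_nonneg_right (norm_abcCrayaMatrix_le A B C i j) (norm_nonneg _)
  have hterm : ∀ j : CrayaIdx, ‖u i‖ * (9 * S * sobolevWeight 1 j.1.1 * ‖u j‖) ≤
      9 * S / 2 * ‖u i‖ ^ 2 + 9 * S / 2 * ((1 + freqNormSq j.1.1) * ‖u j‖ ^ 2) := by
    intro j
    have hw : sobolevWeight 1 j.1.1 ^ 2 = 1 + freqNormSq j.1.1 := sobolevWeight_one_sq _
    have h2 : 2 * ‖u i‖ * (sobolevWeight 1 j.1.1 * ‖u j‖) ≤
        ‖u i‖ ^ 2 + (sobolevWeight 1 j.1.1 * ‖u j‖) ^ 2 := two_mul_le_add_sq _ _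
    rw [← hw]
    nlinarith [h2, hS0]
  calc ‖u i‖ * ‖∑ j ∈ crayaNbr i, abcCrayaMatrix A B C i j * u j‖
      ≤ ‖u i‖ * ∑ j ∈ crayaNbr i, 9 * S * sobolevWeight 1 j.1.1 * ‖u j‖ :=
        mul_le_mul_of_nonneg_left hrow (norm_nonneg _)
    _ = ∑ j ∈ crayaNbr i, ‖u i‖ * (9 * S * sobolevWeight 1 j.1.1 * ‖u j‖) := by rw [Finset.mul_sum]
    _ ≤ ∑ j ∈ crayaNbr i, (9 * S / 2 * ‖u i‖ ^ 2 + 9 * S / 2 * ((1 + freqNormSq j.1.1) * ‖u j‖ ^ 2)) :=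
        Finset.sum_le_sum fun j _ => hterm j
    _ = (crayaNbr i).card * (9 * S / 2 * ‖u i‖ ^ 2) +
          9 * S / 2 * ∑ j ∈ crayaNbr i, (1 + freqNormSq j.1.1) * ‖u j‖ ^ 2 := by
        rw [Finset.sum_add_distrib, Finset.sum_const, nsmul_eq_mul, Finset.mul_sum]
    _ ≤ 12 * (9 * S / 2 * ‖u i‖ ^ 2) +
          9 * S / 2 * ∑ j ∈ crayaNbr i, (1 + freqNormSq j.1.1) * ‖u j‖ ^ 2 := by
        gcongr
        · exact_mod_cast card_crayaNbr_le i
    _ = 9 * S / 2 * 12 * ‖u i‖ ^ 2 + 9 * S / 2 * ∑ j ∈ crayaNbr i, (1 + freqNormSq j.1.1) * ‖u j‖ ^ 2 := by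
        ring

/-- The tail sum over the Craya index set is the frequency sum of the fibre sums. -/
theorem tsum_crayaIdx_eq_tsum_freq {f : CrayaIdx → ℂ} (hf : Summable f) {g : (Fin 3 → ℤ) → ℂ}
    (hg0 : g 0 = 0) (hfg : ∀ k' : {k : Fin 3 → ℤ // k ≠ 0}, ∑ a, f (k', a) = g k'.1) :
    ∑' i, f i = ∑' k, g k := by
  rw [hf.tsum_prod' fun k' => (hasSum_fintype _).summable]
  simp_rw [tsum_fintype, hfg]
  have hsupp : Function.support g ⊆ {k : Fin 3 → ℤ | k ≠ 0} := by
    intro k hk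
    simp only [Function.mem_support] at hk
    exact fun h => hk (by rw [h, hg0])
  exact tsum_subtype_eq_of_support_subset hsupp

/-- **(A4) PAIRING ON THE GRAPH DOMAIN, Craya coordinates** (`abcFlow 1 1 1`): for every coordinate
family `u` with `∑_i (1 + |k_i|²)|u_i|² < ∞` the pairing `i ↦ conj(u_i)(A u)_i` is summable and
`|Re ∑'_i conj(u_i) (A u)_i| ≤ √2 ∑'_i |u_i|²` — the hypothesis `hpair` of
`SkewCutGalerkinTailForm.not_eigenvalue_of_structure` for the operator with matrix `A_ij d_j` in ANY
instantiation of the chain on `CrayaIdx` (there `u = d·w`, an `H²` family), transported from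
implementation 2's Cartesian graph-domain bound `AbcLatticePairingDomain.abs_re_tsum_inner_crossForm_le`
through `crayaSynth`. MODEL statement; not NS. -/
theorem abs_re_tsum_conj_mul_abcCrayaMatrix_le (u : CrayaIdx → ℂ)
    (hu : Summable fun i : CrayaIdx => (1 + freqNormSq i.1.1) * ‖u i‖ ^ 2) :
    Summable (fun i : CrayaIdx => conj (u i) * ∑ j ∈ crayaNbr i, abcCrayaMatrix 1 1 1 i j * u j) ∧
    |(∑' i : CrayaIdx, conj (u i) * ∑ j ∈ crayaNbr i, abcCrayaMatrix 1 1 1 i j * u j).re| ≤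
      Real.sqrt 2 * ∑' i : CrayaIdx, ‖u i‖ ^ 2 := by
  have hf : Summable (fun i : CrayaIdx => conj (u i) * ∑ j ∈ crayaNbr i, abcCrayaMatrix 1 1 1 i j * u j) :=
    (summable_norm_conj_mul_abcCrayaMatrix 1 1 1 u hu).of_norm
  refine ⟨hf, ?_⟩
  -- the synthesised family is an `H¹` family
  have hc : Summable fun k : Fin 3 → ℤ => (1 + freqNormSq k) * ‖crayaSynth u k‖ ^ 2 :=
    summable_weight_norm_sq_crayaSynth u (w := fun k => 1 + freqNormSq k) hu
  obtain ⟨-, hbound⟩ := AbcLatticePairingDomain.abs_re_tsum_inner_crossForm_le (crayaSynth u)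
    (kdot_crayaSynth u) hc
  simp_rw [Torus.sum_abcFreq] at hbound
  -- identify the two tail sums with the Cartesian ones
  have h1 := tsum_crayaIdx_eq_tsum_freq hf (g := fun k => ⟪crayaSynth u k, ∑ y : Fin 3 × Bool,
        WithLp.toLp 2 (WithLp.ofLp (Torus.abcCoeff 1 1 1 (Torus.abcDir y)) ⨯₃
          (Complex.I • ((fun m : Fin 3 => (((k - Torus.abcDir y) m : ℤ) : ℂ)) ⨯₃
            WithLp.ofLp (crayaSynth u (k - Torus.abcDir y))) -
            WithLp.ofLp (crayaSynth u (k - Torus.abcDir y))))⟫_ℂ)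
    (by simp [crayaSynth_zero_freq]) (fun k' => sum_fibre_conj_mul_eq_inner 1 1 1 u k')
  have hu0 : Summable fun i : CrayaIdx => ‖u i‖ ^ 2 := by
    refine Summable.of_nonneg_of_le (fun i => sq_nonneg _) (fun i => ?_) hu
    have := freqNormSq_nonneg i.1.1
    nlinarith [sq_nonneg ‖u i‖]
  have h2 : ∑' i : CrayaIdx, ((‖u i‖ ^ 2 : ℝ) : ℂ) = ∑' k : Fin 3 → ℤ, ((‖crayaSynth u k‖ ^ 2 : ℝ) : ℂ) :=
    tsum_crayaIdx_eq_tsum_freq (Complex.summable_ofReal.mpr hu0) (g := fun k => ((‖crayaSynth u k‖ ^ 2 : ℝ) : ℂ))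
      (by simp [crayaSynth_zero_freq]) (fun k' => by rw [norm_sq_crayaSynth u k'.2]; push_cast; rfl)
  have h2' : ∑' i : CrayaIdx, ‖u i‖ ^ 2 = ∑' k : Fin 3 → ℤ, ‖crayaSynth u k‖ ^ 2 := by
    have hc0 : Summable fun k : Fin 3 → ℤ => ‖crayaSynth u k‖ ^ 2 :=
      summable_weight_norm_sq_crayaSynth u (w := fun _ => (1 : ℝ)) (by simpa using hu0) |>.congr
        fun k => one_mul _
    have := h2
    rw [← Complex.ofReal_tsum, ← Complex.ofReal_tsum] at this
    exact_mod_cast this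
  rw [h1, h2']
  exact hbound

/-! ### §11 `hpair` for the Craya instantiation of the chain -/

/-- Parseval for the squared norm in a Hilbert basis: `∑_i |⟪b i, v⟫|² = ‖v‖²`. -/
theorem hasSum_norm_sq_inner {H : Type*} [NormedAddCommGroup H] [InnerProductSpace ℂ H]
    (b : HilbertBasis CrayaIdx ℂ H) (v : H) : HasSum (fun i => ‖⟪b i, v⟫_ℂ‖ ^ 2) (‖v‖ ^ 2) := by
  have h := b.hasSum_inner_mul_inner v v
  have hre := RCLike.hasSum_re _ h
  rw [← InnerProductSpace.norm_sq_eq_re_inner (𝕜 := ℂ)] at hre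
  refine hre.congr_fun fun i => ?_
  have hci : ⟪v, b i⟫_ℂ = conj ⟪b i, v⟫_ℂ := (inner_conj_symm _ _).symm
  rw [hci, RCLike.conj_mul, ← RCLike.ofReal_pow]
  exact (RCLike.ofReal_re _).symm

/-- **`hpair` of `SkewCutGalerkinTailForm.not_eigenvalue_of_structure` for the Craya instantiation**
(`abcFlow 1 1 1`). For ANY Hilbert basis `b` indexed by the Craya index set, the standard resolvent
symbol `d_i = (x₀ + ν|k_i|²)⁻¹` (`x₀ ≥ 1`) and ANY bounded `T` whose coordinates are those of the
certifier's relative bound, `⟪b i, T x⟫ = ∑'_j (A_ij d_j) ⟪b j, x⟫`: for every `w`,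
`Re ⟪T w, S₀ w⟫ ≤ √2 ‖S₀ w‖²`, `S₀ = b.diagonalCLM d` — with NO restriction to a head complement.
(`u_i := ⟪b i, S₀ w⟫ = d_i ⟪b i, w⟫` is an `H¹` family since `(1 + |k|²)|d_i|² ≤ max 1 ν⁻¹`; then
Parseval + `abs_re_tsum_conj_mul_abcCrayaMatrix_le`.) MODEL statement; not NS. -/
theorem re_inner_apply_diagonal_le {H : Type*} [NormedAddCommGroup H] [InnerProductSpace ℂ H]
    [CompleteSpace H] (b : HilbertBasis CrayaIdx ℂ H) {ν : ℝ} (hν : 0 < ν) (x₀ : ℝ) (hx₀ : 1 ≤ x₀)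
    (d : lp (fun _ : CrayaIdx => ℂ) ⊤)
    (hdform : ∀ i : CrayaIdx, d i = (((x₀ - -(ν * freqNormSq i.1.1))⁻¹ : ℝ) : ℂ))
    (T : H →L[ℂ] H)
    (hTc : ∀ x i, ⟪b i, T x⟫_ℂ = ∑' j, (abcCrayaMatrix 1 1 1 i j * d j) * ⟪b j, x⟫_ℂ) (w : H) :
    RCLike.re ⟪T w, b.diagonalCLM d w⟫_ℂ ≤ Real.sqrt 2 * ‖b.diagonalCLM d w‖ ^ 2 := by
  classical
  set v : H := b.diagonalCLM d w with hv
  obtain ⟨u, hudef⟩ : ∃ u : CrayaIdx → ℂ, ∀ i, u i = ⟪b i, v⟫_ℂ := ⟨_, fun _ => rfl⟩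
  have hu : ∀ i, u i = d i * ⟪b i, w⟫_ℂ := fun i => by
    rw [hudef i, hv, ← b.repr_apply_apply, b.diagonalCLM_apply_repr, b.repr_apply_apply]
  -- the coordinates of `T w`
  have hTi : ∀ i, ⟪b i, T w⟫_ℂ = ∑ j ∈ crayaNbr i, abcCrayaMatrix 1 1 1 i j * u j := by
    intro i
    rw [hTc, tsum_eq_sum (s := crayaNbr i) fun j hj => by
      rw [abcCrayaMatrix_eq_zero_of_not_mem 1 1 1 hj, zero_mul, zero_mul]]
    exact Finset.sum_congr rfl fun j _ => by rw [hu j, mul_assoc]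
  -- `u` is an `H¹` family
  have hdn : ∀ i : CrayaIdx, ‖d i‖ = (x₀ + ν * freqNormSq i.1.1)⁻¹ := fun i => by
    have hpos : 0 < x₀ + ν * freqNormSq i.1.1 := by
      have := mul_nonneg hν.le (freqNormSq_nonneg i.1.1); linarith
    rw [hdform i, sub_neg_eq_add, Complex.norm_real, Real.norm_eq_abs, abs_of_pos (inv_pos.mpr hpos)]
  have hC : ∀ i : CrayaIdx, (1 + freqNormSq i.1.1) * ‖d i‖ ^ 2 ≤ max 1 ν⁻¹ := by
    intro i
    set x := freqNormSq i.1.1 with hx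
    have hx0 : 0 ≤ x := freqNormSq_nonneg _
    have hpos : 0 < x₀ + ν * x := by have := mul_nonneg hν.le hx0; linarith
    have hge1 : 1 ≤ x₀ + ν * x := by have := mul_nonneg hν.le hx0; linarith
    rw [hdn i]
    have hle1 : (x₀ + ν * x)⁻¹ ≤ 1 := inv_le_one_of_one_le₀ hge1
    have hinv0 : 0 ≤ (x₀ + ν * x)⁻¹ := inv_nonneg.mpr hpos.le
    -- (1 + x) d² ≤ (1 + x) d ≤ C
    have h1 : (1 + x) * (x₀ + ν * x)⁻¹ ^ 2 ≤ (1 + x) * (x₀ + ν * x)⁻¹ := by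
      rw [sq]
      exact mul_le_mul_of_nonneg_left (mul_le_of_le_one_right hinv0 hle1) (by linarith)
    have hC1 : (1 : ℝ) ≤ max 1 ν⁻¹ := le_max_left _ _
    have hCν : (1 : ℝ) ≤ max 1 ν⁻¹ * ν :=
      calc (1 : ℝ) = ν⁻¹ * ν := (inv_mul_cancel₀ hν.ne').symm
        _ ≤ max 1 ν⁻¹ * ν := mul_le_mul_of_nonneg_right (le_max_right _ _) hν.le
    have h2 : 1 + x ≤ max 1 ν⁻¹ * (x₀ + ν * x) := by nlinarith
    have h3 : (1 + x) * (x₀ + ν * x)⁻¹ ≤ max 1 ν⁻¹ := by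
      rw [← div_eq_mul_inv, div_le_iff₀ hpos]; exact h2
    exact h1.trans h3
  have hw2 : Summable fun i : CrayaIdx => ‖⟪b i, w⟫_ℂ‖ ^ 2 := (hasSum_norm_sq_inner b w).summable
  have hu1 : Summable fun i : CrayaIdx => (1 + freqNormSq i.1.1) * ‖u i‖ ^ 2 := by
    refine Summable.of_nonneg_of_le (fun i => ?_) (fun i => ?_) (hw2.mul_left (max 1 ν⁻¹))
    · exact mul_nonneg (by linarith [freqNormSq_nonneg i.1.1]) (sq_nonneg _)
    · rw [hu i, norm_mul, mul_pow, ← mul_assoc]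
      exact mul_le_mul_of_nonneg_right (hC i) (sq_nonneg _)
  obtain ⟨hsum, hbound⟩ := abs_re_tsum_conj_mul_abcCrayaMatrix_le u hu1
  -- Parseval for the pairing and for the norm
  have hpar : ⟪T w, v⟫_ℂ = ∑' i, conj (conj (u i) * ∑ j ∈ crayaNbr i, abcCrayaMatrix 1 1 1 i j * u j) := by
    rw [← b.tsum_inner_mul_inner (T w) v]
    refine tsum_congr fun i => ?_
    rw [← inner_conj_symm (T w) (b i), hTi i, map_mul, RCLike.conj_conj, mul_comm, hudef i]
  have hre : RCLike.re ⟪T w, v⟫_ℂ =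
      (∑' i, conj (u i) * ∑ j ∈ crayaNbr i, abcCrayaMatrix 1 1 1 i j * u j).re := by
    rw [hpar, ← Complex.conj_tsum, RCLike.re_eq_complex_re, Complex.conj_re]
  have hnorm : ‖v‖ ^ 2 = ∑' i, ‖u i‖ ^ 2 := by
    rw [← (hasSum_norm_sq_inner b v).tsum_eq]
    exact tsum_congr fun i => by rw [hudef i]
  rw [hre, hnorm]
  exact (le_abs_self _).trans hbound

end Summit.NavierStokesRegularity.FluidComputer.AbcCrayaPairingDomain

end
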